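import Mathlib.Algebra.Order.BigOperators.Ring.Finset
import Mathlib.Algebra.Order.Chebyshev
import Mathlib.Algebra.Ring.GeomSum
import Literature.ComputerArithmetic.ElararEtAl2026.HornerPairwise
import Literature.ComputerArithmetic.ElararEtAl2023.VarianceBoundsProof
import Literature.ComputerArithmetic.HallmanIpsen2023.MartingaleBounds
import HarnessLib

/-!
# El Arar–Fasi–Filip–Mikaitis 2026: Theorems 1 and 2 (Horner's rule and pairwise summation under
# limited-precision stochastic rounding `SR_{p,r}`) PROVED in the limited-precision SR error model

HONEST FRAMING: shared numerical engines serving client cells; rigour lives in the verifiers; every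
published number belongs to a client cell's ledger, not to the engines group.

Source: E.-M. El Arar, M. Fasi, S.-I. Filip, M. Mikaitis, *Probabilistic error analysis of
limited-precision stochastic rounding*, arXiv:2603.24161 (2026) [cite: ArarEtAl2026]; proofs read
from §3 (Lemma 1, Theorem 1 with its proof, eqs. (7)–(12)) and §4 (Theorem 2 with its proof,
eq. (13)) of the materialised preprint.

This file DISCHARGES the two named facts of `ElararEtAl2026.HornerPairwise`:

* `hornerBoundSRpr_holds : hornerBoundSRpr` — **Theorem 1**;
* `pairwiseBoundSRpr_holds : pairwiseBoundSRpr` — **Theorem 2**,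

over the limited-precision SR error model `LimitedSRErrorModel μ u_p u_{p+r} α β` (`δ_k = α_k + β_k`,
`α` mean independent with mean zero and `|α_k| ≤ u_p`, `|β_k| ≤ u_{p+r}`).

**The argument (the source's, made uniform).** Both algorithms compute a "recursive sum"
`Σ_{i∈I} cᵢ ∏_{k∈Kᵢ} (1+δ_k)` with `|Kᵢ| ≤ N` (`N = 2n` for Horner, `N = h` for the summation tree).
(i) *Deterministic part* (Lemma 1 and eqs. (10)–(11)): `∏_{Kᵢ}(1+α_k+β_k) = ∏_{Kᵢ}(1+α_k) + Bᵢ`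
with `|Bᵢ| ≤ γ_{|Kᵢ|}(u_p+u_{p+r}) − γ_{|Kᵢ|}(u_p) ≤ γ_N(u_p+u_{p+r}) − γ_N(u_p)` (the proved
`abs_prod_sub_prod_le` of the fact file plus monotonicity of `m ↦ γ_m(a+b) − γ_m(a)`), whence
`|Σcᵢ∏_{Kᵢ}(1+δ_k) − Σcᵢ| ≤ |M| + (Σ|cᵢ|)(γ_N(u_p+u_{p+r}) − γ_N(u_p))` with
`M = Σcᵢ∏_{Kᵢ}(1+α_k) − Σcᵢ` the error of the same algorithm under the mean-independent errors `α`
alone (`abs_err_le_abs_err_add_bias`, `measure_err_gt_le_of_split`).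
(ii) *Probabilistic part.* For Theorem 1 the source bounds `M` by [8, Theorem 4.5] = El Arar et al.
2023, Theorem 4.5, which is the tree's PROVED `ElararEtAl2023.measure_err_gt_le_AH` (radius
`(Σ|aᵢxⁱ|)√(u_pγ_{4n}(u_p))√(ln(2/λ))`), eq. (12). For Theorem 2 the source invokes [9, Theorem 3.5]
(El Arar–Sohier–de Oliveira Castro–Petit, SIAM J. Sci. Comput. 46(5) (2024) B579–B599), which is
NOT in the tree; we prove the bound with the radius `(Σ|aᵢ|)√(u_pγ_{2h}(u_p))√(ln(2/λ))` that
eq. (13) / `pairwiseEnvelope` actually use, by the Azuma–Hoeffding argument of [8, Thm. 4.5] run on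
the summation tree (`pwSum_measure_err_gt_le_AH`): the error `ŝ − s = Σ_k T_k α_k` is a martingale
transform (`ElararEtAl2023.ahCoef`, `err_eq_transform_of_subset_range`) whose coefficient at the time
`k = ι(j,m)` of node `(j,m)` is surely bounded by `(1+u_p)^{j−1} Σ_{leaves i under (j,m)} |aᵢ|`
(`abs_ahCoef_le_timeBound`); summing the squares level by level,
`Σ_k T_k² ≤ (Σ|aᵢ|)² Σ_{j<h} (1+u_p)^{2j}` and `2u_p² Σ_{j<h}(1+u_p)^{2j} ≤ u_p γ_{2h}(u_p)`
(`two_mul_sum_timeBound_sq_le`), so Hallman–Ipsen's `azumaHoeffding` gives the claim. The tree is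
read through an admissible `TreeNumbering` exactly as in the fact file; admissibility (injective,
increasing towards the root) is what makes the leaf products `∏_{j=1}^{h}(1+δ_{ι(j,⌊i/2^j⌋)})`
products over SETS of time indices (`pairwiseComputed_eq_sum_prod`) and the coefficients predictable.

No hypothesis `u_p < 1`, `λ < 1` or `u_{p+r} ≤ u_p` is used beyond `0 ≤ u_{p+r}`, `0 ≤ u_p` (the
facts carry them because the source does).
-/

namespace Literature.ComputerArithmetic.ElararEtAl2026

open _root_.MeasureTheory
open Finset
open Literature.ComputerArithmetic.ConnollyHighamMary2021 (SRErrorModel)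
open Literature.ComputerArithmetic.ElararEtAl2023 (ahCoef isPredictable_ahCoef measure_err_gt_le_AH
  hornerIndex_subset card_hornerIndex_le)
open Literature.ComputerArithmetic.HallmanIpsen2023 (transform azumaRadius azumaHoeffding u_nonneg)

/-! ### The deterministic part: Lemma 1 termwise, eqs. (10)–(11) -/

section Deterministic

/-- **Eq. (10), the comparison `|Bᵢ| ≤ |B₁|`:** `m ↦ γ_m(a+b) − γ_m(a)` is monotone for `a, b ≥ 0`
(`γ_{m+1}(a+b) − γ_{m+1}(a) − (γ_m(a+b) − γ_m(a)) = ((1+a+b)^m − (1+a)^m)(a+b) + (1+a)^m b ≥ 0`).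
[cite: ArarEtAl2026, Thm. 1 proof, eq. (10)] -/
theorem gammaFn_sub_mono {a b : ℝ} (ha : 0 ≤ a) (hb : 0 ≤ b) {m m' : ℕ} (hmm' : m ≤ m') :
    gammaFn m (a + b) - gammaFn m a ≤ gammaFn m' (a + b) - gammaFn m' a := by
  have hmono : Monotone (fun m : ℕ => gammaFn m (a + b) - gammaFn m a) := by
    refine monotone_nat_of_le_succ (fun m => ?_)
    rw [← sub_nonneg]
    have hid : gammaFn (m + 1) (a + b) - gammaFn (m + 1) a - (gammaFn m (a + b) - gammaFn m a)
        = ((1 + a + b) ^ m - (1 + a) ^ m) * (a + b) + (1 + a) ^ m * b := by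
      simp only [gammaFn, pow_succ]; ring
    rw [hid]
    have h1 : (1 + a) ^ m ≤ (1 + a + b) ^ m := pow_le_pow_left₀ (by linarith) (by linarith) m
    have h2 : 0 ≤ (1 + a) ^ m := pow_nonneg (by linarith) m
    exact add_nonneg (mul_nonneg (sub_nonneg.mpr h1) (add_nonneg ha hb)) (mul_nonneg h2 hb)
  exact hmono hmm'

/-- **Lemma 1 applied termwise, eqs. (10)–(11):** for a recursive sum `Σ_{i∈I} cᵢ ∏_{k∈Kᵢ}(1+α_k+β_k)`
with `|α_k| ≤ a`, `|β_k| ≤ b` (`a, b ≥ 0`) and `|Kᵢ| ≤ N`,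
`|Σcᵢ∏_{Kᵢ}(1+α_k+β_k) − Σcᵢ| ≤ |Σcᵢ∏_{Kᵢ}(1+α_k) − Σcᵢ| + (Σ|cᵢ|)(γ_N(a+b) − γ_N(a))`
(the display `|ŝ − s| ≤ |M| + Σ|aᵢ||Bᵢ|` of both proofs, with `|Bᵢ| ≤ γ_N(u_p+u_{p+r}) − γ_N(u_p)`).
[cite: ArarEtAl2026, Thm. 1 proof eqs. (10)–(11); Thm. 2 proof] -/
theorem abs_err_le_abs_err_add_bias {σ : Type*} (I : Finset σ) (c : σ → ℝ) (K : σ → Finset ℕ)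
    (α β : ℕ → ℝ) {a b : ℝ} (ha : 0 ≤ a) (hb : 0 ≤ b) (hα : ∀ k, |α k| ≤ a) (hβ : ∀ k, |β k| ≤ b)
    {N : ℕ} (hN : ∀ i ∈ I, (K i).card ≤ N) :
    |(∑ i ∈ I, c i * ∏ k ∈ K i, (1 + (α k + β k))) - ∑ i ∈ I, c i|
      ≤ |(∑ i ∈ I, c i * ∏ k ∈ K i, (1 + α k)) - ∑ i ∈ I, c i|
        + (∑ i ∈ I, |c i|) * (gammaFn N (a + b) - gammaFn N a) := by
  have hsplit : (∑ i ∈ I, c i * ∏ k ∈ K i, (1 + (α k + β k))) - ∑ i ∈ I, c i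
      = ((∑ i ∈ I, c i * ∏ k ∈ K i, (1 + α k)) - ∑ i ∈ I, c i)
        + ∑ i ∈ I, c i * ((∏ k ∈ K i, (1 + (α k + β k))) - ∏ k ∈ K i, (1 + α k)) := by
    have : ∑ i ∈ I, c i * ∏ k ∈ K i, (1 + (α k + β k))
        = ∑ i ∈ I, c i * ∏ k ∈ K i, (1 + α k)
          + ∑ i ∈ I, c i * ((∏ k ∈ K i, (1 + (α k + β k))) - ∏ k ∈ K i, (1 + α k)) := by
      rw [← Finset.sum_add_distrib]
      exact Finset.sum_congr rfl (fun i _ => by ring)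
    rw [this]; ring
  have hbias : |∑ i ∈ I, c i * ((∏ k ∈ K i, (1 + (α k + β k))) - ∏ k ∈ K i, (1 + α k))|
      ≤ (∑ i ∈ I, |c i|) * (gammaFn N (a + b) - gammaFn N a) := by
    rw [Finset.sum_mul]
    refine (Finset.abs_sum_le_sum_abs _ _).trans (Finset.sum_le_sum (fun i hi => ?_))
    rw [abs_mul]
    refine mul_le_mul_of_nonneg_left ?_ (abs_nonneg _)
    exact (abs_prod_sub_prod_le (K i) α β ha (fun k _ => hα k) (fun k _ => hβ k)).trans
      (gammaFn_sub_mono ha hb (hN i hi))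
  rw [hsplit]
  exact (abs_add_le _ _).trans (add_le_add le_rfl hbias)

end Deterministic

/-! ### The summation tree as a recursive sum over sets of time indices -/

section Tree

variable {h : ℕ} {ι : ℕ → ℕ → ℕ}

/-- The time indices met by leaf `i` on its root path: `Kᵢ = {ι(j, ⌊i/2^j⌋) : 1 ≤ j ≤ h}`.
[cite: ArarEtAl2026, §4 (display before Thm. 2: `ŝ = Σᵢ aᵢ ∏_{j=1}^{h}(1+δ_{j,⌊i/2^j⌋})`)] -/
def pwIndex (h : ℕ) (ι : ℕ → ℕ → ℕ) (i : ℕ) : Finset ℕ :=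
  (Icc 1 h).image (fun j => ι j (i / 2 ^ j))

/-- [folklore] a leaf `i < 2^h` sits under node `⌊i/2^j⌋ < 2^{h−j}` of level `j ≤ h`. -/
private theorem div_pow_lt {h i j : ℕ} (hi : i < 2 ^ h) (hj : j ≤ h) : i / 2 ^ j < 2 ^ (h - j) := by
  rw [Nat.div_lt_iff_lt_mul (by positivity)]
  rwa [← pow_add, Nat.sub_add_cancel hj]

/-- [folklore] the parent of node `⌊i/2^j⌋` is `⌊i/2^{j+1}⌋ = ⌊⌊i/2^j⌋/2⌋`. -/
private theorem div_pow_succ (i j : ℕ) : i / 2 ^ j / 2 = i / 2 ^ (j + 1) := by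
  rw [Nat.div_div_eq_div_mul, pow_succ]

/-- Along the root path of a leaf an admissible numbering increases: for `i < 2^h` and
`1 ≤ j < j' ≤ h`, `ι(j, ⌊i/2^j⌋) < ι(j', ⌊i/2^{j'}⌋)` (iterate `TreeNumbering.mono`).
[cite: ArarEtAl2026, §4] -/
theorem TreeNumbering.path_lt (hι : TreeNumbering h ι) {i : ℕ} (hi : i < 2 ^ h) {j j' : ℕ}
    (hj : 1 ≤ j) (hjj' : j < j') (hj' : j' ≤ h) : ι j (i / 2 ^ j) < ι j' (i / 2 ^ j') := by
  obtain ⟨d, rfl⟩ : ∃ d, j' = j + 1 + d := ⟨j' - (j + 1), by omega⟩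
  induction d with
  | zero =>
    have h1 := hι.mono j (i / 2 ^ j) hj (by omega) (div_pow_lt hi (by omega))
    rw [div_pow_succ] at h1
    simpa using h1
  | succ d ih =>
    have h1 := ih (by omega) (by omega)
    have h2 := hι.mono (j + 1 + d) (i / 2 ^ (j + 1 + d)) (by omega) (by omega)
      (div_pow_lt hi (by omega))
    rw [div_pow_succ] at h2
    rw [show j + 1 + (d + 1) = j + 1 + d + 1 by omega]
    exact h1.trans h2

/-- Hence the root path `j ↦ ι(j, ⌊i/2^j⌋)` of a leaf `i < 2^h` is injective on the levels
`1 ≤ j ≤ h`. [cite: ArarEtAl2026, §4] -/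
theorem TreeNumbering.path_injOn (hι : TreeNumbering h ι) {i : ℕ} (hi : i < 2 ^ h) :
    Set.InjOn (fun j => ι j (i / 2 ^ j)) ↑(Icc 1 h) := by
  intro j hj j' hj' hjj
  obtain ⟨hj1, hjh⟩ := Finset.mem_Icc.mp (Finset.mem_coe.mp hj)
  obtain ⟨hj'1, hj'h⟩ := Finset.mem_Icc.mp (Finset.mem_coe.mp hj')
  simp only at hjj
  rcases lt_trichotomy j j' with hlt | heq | hgt
  · exact absurd hjj (hι.path_lt hi hj1 hlt hj'h).ne
  · exact heq
  · exact absurd hjj.symm (hι.path_lt hi hj'1 hgt hjh).ne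

/-- **The computed pairwise sum is a recursive sum over the index SETS `Kᵢ`:**
`ŝ = Σ_{i<2^h} aᵢ ∏_{k∈Kᵢ}(1+e_k)` for every admissible numbering (the `h` path indices are
distinct). [cite: ArarEtAl2026, §4 (display before Thm. 2)] -/
theorem pairwiseComputed_eq_sum_prod (hι : TreeNumbering h ι) (a : ℕ → ℝ) (e : ℕ → ℝ) :
    pairwiseComputed h a ι e = ∑ i ∈ range (2 ^ h), a i * ∏ k ∈ pwIndex h ι i, (1 + e k) := by
  unfold pairwiseComputed pwIndex
  refine Finset.sum_congr rfl (fun i hi => ?_)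
  rw [Finset.prod_image (hι.path_injOn (Finset.mem_range.mp hi))]

/-- Each leaf meets at most `h` rounding errors: `|Kᵢ| ≤ h`.
[cite: ArarEtAl2026, Thm. 2 proof (`|Bᵢ| ≤ γ_h(u_p+u_{p+r}) − γ_h(u_p)`: products of `h` factors)] -/
theorem card_pwIndex_le (h : ℕ) (ι : ℕ → ℕ → ℕ) (i : ℕ) : (pwIndex h ι i).card ≤ h :=
  Finset.card_image_le.trans (by simp)

/-- The internal nodes `(j, m)` of the summation tree: levels `1 ≤ j ≤ h`, positions `m < 2^{h−j}`.
[cite: ArarEtAl2026, §4] -/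
def pwNodes (h : ℕ) : Finset (ℕ × ℕ) :=
  (Icc 1 h ×ˢ range (2 ^ h)).filter (fun ν => ν.2 < 2 ^ (h - ν.1))

/-- The time index of a node under the numbering `ι`. [cite: ArarEtAl2026, §4] -/
def nodeTime (ι : ℕ → ℕ → ℕ) (ν : ℕ × ℕ) : ℕ := ι ν.1 ν.2

/-- Membership in `pwNodes`. [cite: ArarEtAl2026, §4] -/
theorem mem_pwNodes {h : ℕ} {ν : ℕ × ℕ} :
    ν ∈ pwNodes h ↔ 1 ≤ ν.1 ∧ ν.1 ≤ h ∧ ν.2 < 2 ^ (h - ν.1) := by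
  simp only [pwNodes, Finset.mem_filter, Finset.mem_product, Finset.mem_Icc, Finset.mem_range]
  constructor
  · rintro ⟨⟨⟨h1, h2⟩, -⟩, h3⟩
    exact ⟨h1, h2, h3⟩
  · rintro ⟨h1, h2, h3⟩
    exact ⟨⟨⟨h1, h2⟩, lt_of_lt_of_le h3 (Nat.pow_le_pow_right (by norm_num) (Nat.sub_le h ν.1))⟩,
      h3⟩

/-- An admissible numbering assigns each time index to at most one node.
[cite: ArarEtAl2026, §4] -/
theorem card_filter_nodeTime_le_one (hι : TreeNumbering h ι) (k : ℕ) :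
    ((pwNodes h).filter (fun ν => nodeTime ι ν = k)).card ≤ 1 := by
  refine Finset.card_le_one.mpr (fun ν hν ν' hν' => ?_)
  obtain ⟨hν, hνk⟩ := Finset.mem_filter.mp hν
  obtain ⟨hν', hν'k⟩ := Finset.mem_filter.mp hν'
  obtain ⟨h1, h2, h3⟩ := mem_pwNodes.mp hν
  obtain ⟨h1', h2', h3'⟩ := mem_pwNodes.mp hν'
  obtain ⟨hj, hm⟩ := hι.inj ν.1 ν.2 ν'.1 ν'.2 h1 h2 h3 h1' h2' h3' (hνk.trans hν'k.symm)
  exact Prod.ext hj hm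

/-- The leaf mass under node `(j, m)`: `L_{j,m} = Σ_{i<2^h, ⌊i/2^j⌋ = m} |aᵢ|`.
[cite: ArarEtAl2026, Thm. 2 proof (the martingale `M`, via [9, Thm. 3.5])] -/
def leafSum (h : ℕ) (a : ℕ → ℝ) (j m : ℕ) : ℝ :=
  ∑ i ∈ (range (2 ^ h)).filter (fun i => i / 2 ^ j = m), |a i|

/-- The sure bound on the martingale increment coefficient contributed by node `(j, m)`:
`(1+u)^{j−1} L_{j,m}` (the partial product below the node has `j − 1` factors of modulus `≤ 1+u`).
[cite: ArarEtAl2026, Thm. 2 proof (the martingale `M`, via [9, Thm. 3.5])] -/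
def nodeBound (h : ℕ) (a : ℕ → ℝ) (u : ℝ) (ν : ℕ × ℕ) : ℝ :=
  (1 + u) ^ (ν.1 - 1) * leafSum h a ν.1 ν.2

/-- The sure bound `A_k` on the coefficient of the error `α_k` at time `k`: the bound of the node
numbered `k` (zero if no node is). [cite: ArarEtAl2026, Thm. 2 proof (the martingale `M`)] -/
def timeBound (h : ℕ) (ι : ℕ → ℕ → ℕ) (a : ℕ → ℝ) (u : ℝ) (k : ℕ) : ℝ :=
  ∑ ν ∈ (pwNodes h).filter (fun ν => nodeTime ι ν = k), nodeBound h a u ν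

/-- [folklore] exchanging a filtered sum over nodes with a filtered sum over leaves. -/
private theorem sum_filter_sum_filter_comm {κ τ : Type*} (S : Finset κ) (T : Finset τ)
    (p : κ → Prop) [DecidablePred p] (q : κ → τ → Prop) [∀ ν, DecidablePred (q ν)]
    (f : κ → τ → ℝ) :
    ∑ ν ∈ S.filter p, ∑ i ∈ T.filter (q ν), f ν i
      = ∑ i ∈ T, ∑ ν ∈ S.filter (fun ν => p ν ∧ q ν i), f ν i := by
  rw [Finset.sum_filter]
  have hν : ∀ ν ∈ S, (if p ν then ∑ i ∈ T.filter (q ν), f ν i else 0)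
      = ∑ i ∈ T, if (p ν ∧ q ν i) then f ν i else 0 := by
    intro ν _
    by_cases hp : p ν
    · rw [if_pos hp, Finset.sum_filter]
      exact Finset.sum_congr rfl (fun i _ => by simp [hp])
    · rw [if_neg hp]
      exact (Finset.sum_eq_zero (fun i _ => by simp [hp])).symm
  rw [Finset.sum_congr rfl hν, Finset.sum_comm]
  exact Finset.sum_congr rfl (fun i _ => (Finset.sum_filter _ _).symm)

/-- `A_k` read leaf by leaf: `A_k = Σ_{i<2^h} Σ_{nodes (j,m) numbered k above i} (1+u)^{j−1}|aᵢ|`.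
[cite: ArarEtAl2026, Thm. 2 proof (the martingale `M`)] -/
theorem timeBound_eq_sum_leaf (h : ℕ) (ι : ℕ → ℕ → ℕ) (a : ℕ → ℝ) (u : ℝ) (k : ℕ) :
    timeBound h ι a u k = ∑ i ∈ range (2 ^ h),
      ∑ ν ∈ (pwNodes h).filter (fun ν => nodeTime ι ν = k ∧ i / 2 ^ ν.1 = ν.2),
        (1 + u) ^ (ν.1 - 1) * |a i| := by
  unfold timeBound nodeBound leafSum
  simp_rw [Finset.mul_sum]
  exact sum_filter_sum_filter_comm (pwNodes h) (range (2 ^ h)) (fun ν => nodeTime ι ν = k)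
    (fun ν i => i / 2 ^ ν.1 = ν.2) (fun ν i => (1 + u) ^ (ν.1 - 1) * |a i|)

/-- [folklore] the square of a sum with at most one term. -/
private theorem sq_sum_eq_of_card_le_one {κ : Type*} (s : Finset κ) (w : κ → ℝ) (hs : s.card ≤ 1) :
    (∑ x ∈ s, w x) ^ 2 = ∑ x ∈ s, w x ^ 2 := by
  rcases Nat.le_one_iff_eq_zero_or_eq_one.mp hs with h0 | h1
  · rw [Finset.card_eq_zero.mp h0]; simp
  · obtain ⟨x, hx⟩ := Finset.card_eq_one.mp h1
    rw [hx]; simp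

/-- **The sum of the squared increment bounds, level by level:** if every node is numbered below `N`,
`Σ_{k<N} A_k² = Σ_{nodes} ((1+u)^{j−1}L_{j,m})² ≤ (Σ|aᵢ|)² Σ_{j<h} (1+u)^{2j}`
(`Σ_m L_{j,m}² ≤ (Σ_m L_{j,m})² = (Σ|aᵢ|)²` on each level).
[cite: ArarEtAl2026, Thm. 2 proof (the martingale `M`, via [9, Thm. 3.5])] -/
theorem sum_timeBound_sq_le (hι : TreeNumbering h ι) (a : ℕ → ℝ) (u : ℝ) {N : ℕ}
    (hN : ∀ ν ∈ pwNodes h, nodeTime ι ν < N) :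
    ∑ k ∈ range N, (timeBound h ι a u k) ^ 2
      ≤ (∑ i ∈ range (2 ^ h), |a i|) ^ 2 * ∑ j ∈ range h, ((1 + u) ^ 2) ^ j := by
  set S := ∑ i ∈ range (2 ^ h), |a i| with hSdef
  have h1 : ∑ k ∈ range N, (timeBound h ι a u k) ^ 2 = ∑ ν ∈ pwNodes h, (nodeBound h a u ν) ^ 2 := by
    unfold timeBound
    rw [Finset.sum_congr rfl (fun k _ =>
      sq_sum_eq_of_card_le_one _ (nodeBound h a u) (card_filter_nodeTime_le_one hι k))]
    exact Finset.sum_fiberwise_of_maps_to (fun ν hν => Finset.mem_range.mpr (hN ν hν)) _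
  have hL : ∀ j, ∑ m ∈ range (2 ^ h), leafSum h a j m = S := by
    intro j
    unfold leafSum
    exact Finset.sum_fiberwise_of_maps_to (g := fun i => i / 2 ^ j)
      (fun i hi => Finset.mem_range.mpr
        (lt_of_le_of_lt (Nat.div_le_self _ _) (Finset.mem_range.mp hi))) _
  have hLnn : ∀ j m, 0 ≤ leafSum h a j m := fun j m => Finset.sum_nonneg (fun _ _ => abs_nonneg _)
  have h2 : ∑ ν ∈ pwNodes h, (nodeBound h a u ν) ^ 2
      = ∑ j ∈ Icc 1 h, ((1 + u) ^ (j - 1)) ^ 2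
          * ∑ m ∈ (range (2 ^ h)).filter (fun m => m < 2 ^ (h - j)), (leafSum h a j m) ^ 2 := by
    unfold pwNodes nodeBound
    rw [Finset.sum_filter, Finset.sum_product]
    refine Finset.sum_congr rfl (fun j _ => ?_)
    rw [Finset.mul_sum, Finset.sum_filter]
    refine Finset.sum_congr rfl (fun m _ => ?_)
    by_cases hm : m < 2 ^ (h - j)
    · simp [hm, mul_pow]
    · simp [hm]
  have h3 : ∀ j ∈ Icc 1 h,
      ∑ m ∈ (range (2 ^ h)).filter (fun m => m < 2 ^ (h - j)), (leafSum h a j m) ^ 2 ≤ S ^ 2 := by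
    intro j _
    calc ∑ m ∈ (range (2 ^ h)).filter (fun m => m < 2 ^ (h - j)), (leafSum h a j m) ^ 2
        ≤ (∑ m ∈ (range (2 ^ h)).filter (fun m => m < 2 ^ (h - j)), leafSum h a j m) ^ 2 :=
          Finset.sum_sq_le_sq_sum_of_nonneg (fun m _ => hLnn j m)
      _ ≤ (∑ m ∈ range (2 ^ h), leafSum h a j m) ^ 2 :=
          pow_le_pow_left₀ (Finset.sum_nonneg (fun m _ => hLnn j m))
            (Finset.sum_le_sum_of_subset_of_nonneg (Finset.filter_subset _ _)
              (fun m _ _ => hLnn j m)) 2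
      _ = S ^ 2 := by rw [hL j]
  rw [h1, h2]
  calc ∑ j ∈ Icc 1 h, ((1 + u) ^ (j - 1)) ^ 2
          * ∑ m ∈ (range (2 ^ h)).filter (fun m => m < 2 ^ (h - j)), (leafSum h a j m) ^ 2
      ≤ ∑ j ∈ Icc 1 h, ((1 + u) ^ (j - 1)) ^ 2 * S ^ 2 :=
        Finset.sum_le_sum (fun j hj => mul_le_mul_of_nonneg_left (h3 j hj) (sq_nonneg _))
    _ = S ^ 2 * ∑ j ∈ range h, ((1 + u) ^ 2) ^ j := by
        have hIcc : Icc 1 h = Ico 1 (h + 1) := by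
          ext j
          simp only [Finset.mem_Icc, Finset.mem_Ico]
          omega
        rw [Finset.mul_sum, hIcc, Finset.sum_Ico_eq_sum_range]
        simp only [Nat.add_sub_cancel, Nat.add_sub_cancel_left]
        exact Finset.sum_congr rfl (fun j _ => by rw [← pow_mul, ← pow_mul, Nat.mul_comm j 2]; ring)

/-- **`2 Σ_{k<N} (A_k u)² ≤ (Σ|aᵢ|)² u γ_{2h}(u)`** for `u ≥ 0`: with `q = (1+u)²`,
`(Σ_{j<h} q^j)(q − 1) = (1+u)^{2h} − 1 = γ_{2h}(u)` and `q − 1 = 2u + u² ≥ 2u`.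
[cite: ArarEtAl2026, Thm. 2 eq. (13) (the radius `√(u_pγ_{2h}(u_p))`)] -/
theorem two_mul_sum_timeBound_sq_le (hι : TreeNumbering h ι) (a : ℕ → ℝ) {u : ℝ} (hu : 0 ≤ u)
    {N : ℕ} (hN : ∀ ν ∈ pwNodes h, nodeTime ι ν < N) :
    2 * ∑ k ∈ range N, (timeBound h ι a u k * u) ^ 2
      ≤ (∑ i ∈ range (2 ^ h), |a i|) ^ 2 * (u * gammaFn (2 * h) u) := by
  set S := ∑ i ∈ range (2 ^ h), |a i| with hSdef
  set G := ∑ j ∈ range h, ((1 + u) ^ 2) ^ j with hGdef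
  have hsum : ∑ k ∈ range N, (timeBound h ι a u k * u) ^ 2
      = u ^ 2 * ∑ k ∈ range N, (timeBound h ι a u k) ^ 2 := by
    rw [Finset.mul_sum]
    exact Finset.sum_congr rfl (fun k _ => by ring)
  have hle : u ^ 2 * ∑ k ∈ range N, (timeBound h ι a u k) ^ 2 ≤ u ^ 2 * (S ^ 2 * G) :=
    mul_le_mul_of_nonneg_left (sum_timeBound_sq_le hι a u hN) (sq_nonneg u)
  have hgeom : G * ((1 + u) ^ 2 - 1) = gammaFn (2 * h) u := by
    rw [hGdef, geom_sum_mul, ← pow_mul, gammaFn]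
  have hG : 0 ≤ G := Finset.sum_nonneg (fun _ _ => pow_nonneg (sq_nonneg _) _)
  have hS : 0 ≤ S ^ 2 := sq_nonneg S
  rw [hsum, ← hgeom]
  nlinarith [hle, mul_nonneg (mul_nonneg hS (pow_nonneg hu 3)) hG]

/-- [folklore] `√(2σ²)√(ln(2/λ)) ≤ S√G√(ln(2/λ))` as soon as `2σ² ≤ S²G` and `S ≥ 0`. -/
private theorem azumaRadius_le_of_two_mul_le {σsq S G : ℝ} (lam : ℝ) (hS : 0 ≤ S)
    (h2 : 2 * σsq ≤ S ^ 2 * G) :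
    azumaRadius σsq lam ≤ S * (Real.sqrt G * Real.sqrt (Real.log (2 / lam))) := by
  have hL : 0 ≤ Real.sqrt (Real.log (2 / lam)) := Real.sqrt_nonneg _
  have hrad : azumaRadius σsq lam = Real.sqrt (2 * σsq) * Real.sqrt (Real.log (2 / lam)) := by
    rw [azumaRadius, Real.sqrt_mul (by norm_num : (0:ℝ) ≤ 2) (Real.log (2 / lam)),
      Real.sqrt_mul (by norm_num : (0:ℝ) ≤ 2) σsq]
    ring
  have henv : S * Real.sqrt G = Real.sqrt (S ^ 2 * G) := by
    rw [Real.sqrt_mul (sq_nonneg S), Real.sqrt_sq hS]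
  rw [hrad, ← mul_assoc, henv]
  exact mul_le_mul_of_nonneg_right (Real.sqrt_le_sqrt h2) hL

end Tree

/-! ### The probabilistic part: the error under mean-independent errors is a martingale transform -/

section Pathwise

variable {Ω : Type}

/-- **The error of a recursive sum is a martingale transform** (range form of
`ElararEtAl2023.err_eq_transform`): if every `Kᵢ ⊆ [0, N)` then
`Σcᵢ∏_{Kᵢ}(1+δ_k) − Σcᵢ = Σ_{k<N} T_k(δ) δ_k` with the predictable coefficients `T_k = ahCoef`.
[cite: ArarEtAl2026, Thm. 1 proof eq. (12) (via [8, Thm. 4.5]); Thm. 2 proof (the martingale `M`)] -/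
theorem err_eq_transform_of_subset_range {σ : Type*} (I : Finset σ) (c : σ → ℝ) (K : σ → Finset ℕ)
    {N : ℕ} (hN : ∀ i ∈ I, K i ⊆ range N) (δ : ℕ → Ω → ℝ) (ω : Ω) :
    (∑ i ∈ I, c i * ∏ k ∈ K i, (1 + δ k ω)) - ∑ i ∈ I, c i
      = transform (fun k ω => ahCoef I c K k (fun j => δ j ω)) δ N ω := by
  rw [transform]
  have herr : (∑ i ∈ I, c i * ∏ k ∈ K i, (1 + δ k ω)) - ∑ i ∈ I, c i
      = ∑ i ∈ I, c i * ((∏ k ∈ K i, (1 + δ k ω)) - 1) := by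
    rw [← Finset.sum_sub_distrib]
    exact Finset.sum_congr rfl (fun i _ => by ring)
  rw [herr]
  have htel : ∀ i ∈ I, c i * ((∏ k ∈ K i, (1 + δ k ω)) - 1)
      = ∑ k ∈ K i, c i * (δ k ω * ∏ j ∈ K i with j < k, (1 + δ j ω)) := by
    intro i _
    rw [Finset.prod_one_add_ordered, add_sub_cancel_left, Finset.mul_sum]
  rw [Finset.sum_congr rfl htel]
  rw [Finset.sum_comm' (t' := range N) (s' := fun k => I.filter (fun i => k ∈ K i))]
  · refine Finset.sum_congr rfl (fun k _ => ?_)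
    rw [ahCoef, Finset.sum_mul]
    exact Finset.sum_congr rfl (fun i _ => by ring)
  · intro i k
    simp only [Finset.mem_filter, Finset.mem_range]
    constructor
    · rintro ⟨hi, hk⟩
      exact ⟨⟨hi, hk⟩, Finset.mem_range.mp (hN i hi hk)⟩
    · rintro ⟨⟨hi, hk⟩, _⟩
      exact ⟨hi, hk⟩

end Pathwise

section Model

variable {Ω : Type} [MeasurableSpace Ω] {μ : Measure Ω} {u : ℝ} {δ : ℕ → Ω → ℝ}
  {h : ℕ} {ι : ℕ → ℕ → ℕ}

/-- **The tree coefficients are surely bounded: `|T_k(δ)| ≤ A_k`.** If `k = ι(j₀, m₀)` then the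
leaves `i` with `k ∈ Kᵢ` are those under `(j₀, m₀)`, and the factors of `Kᵢ` before time `k` are the
`j₀ − 1` lower levels of the path, each of modulus `≤ 1 + u`.
[cite: ArarEtAl2026, Thm. 2 proof (the martingale `M`, via [9, Thm. 3.5])] -/
theorem abs_ahCoef_le_timeBound (hm : SRErrorModel μ u δ) (hι : TreeNumbering h ι) (a : ℕ → ℝ)
    (k : ℕ) (ω : Ω) :
    |ahCoef (range (2 ^ h)) a (pwIndex h ι) k (fun j => δ j ω)| ≤ timeBound h ι a u k := by
  have hu : 0 ≤ u := (abs_nonneg _).trans (hm.bounded 0 ω)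
  have h1u : (1 : ℝ) ≤ 1 + u := by linarith
  have hterm : ∀ i ∈ (range (2 ^ h)).filter (fun i => k ∈ pwIndex h ι i),
      |a i * ∏ j ∈ (pwIndex h ι i).filter (fun j => j < k), (1 + δ j ω)|
        ≤ ∑ ν ∈ (pwNodes h).filter (fun ν => nodeTime ι ν = k ∧ i / 2 ^ ν.1 = ν.2),
            (1 + u) ^ (ν.1 - 1) * |a i| := by
    intro i hi
    obtain ⟨hi2, hk⟩ := Finset.mem_filter.mp hi
    have hi2' : i < 2 ^ h := Finset.mem_range.mp hi2
    simp only [pwIndex, Finset.mem_image] at hk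
    obtain ⟨j₀, hj₀, hj₀k⟩ := hk
    obtain ⟨hj₀1, hj₀h⟩ := Finset.mem_Icc.mp hj₀
    -- the factors of `Kᵢ` before time `k` come from the levels `1 ≤ j < j₀`
    have hsub : (pwIndex h ι i).filter (fun j => j < k)
        ⊆ (Ico 1 j₀).image (fun j => ι j (i / 2 ^ j)) := by
      intro x hx
      obtain ⟨hx1, hxk⟩ := Finset.mem_filter.mp hx
      simp only [pwIndex, Finset.mem_image] at hx1
      obtain ⟨j', hj', rfl⟩ := hx1
      obtain ⟨hj'1, hj'h⟩ := Finset.mem_Icc.mp hj'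
      refine Finset.mem_image.mpr ⟨j', Finset.mem_Ico.mpr ⟨hj'1, ?_⟩, rfl⟩
      by_contra hjj
      rcases (not_lt.mp hjj).eq_or_lt with heq | hlt
      · rw [← heq, hj₀k] at hxk
        exact lt_irrefl _ hxk
      · have hlt' := hι.path_lt hi2' hj₀1 hlt hj'h
        rw [hj₀k] at hlt'
        exact lt_asymm hlt' hxk
    have hcard : ((pwIndex h ι i).filter (fun j => j < k)).card ≤ j₀ - 1 :=
      (Finset.card_le_card hsub).trans (Finset.card_image_le.trans (by simp))
    have hprod : |∏ j ∈ (pwIndex h ι i).filter (fun j => j < k), (1 + δ j ω)|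
        ≤ (1 + u) ^ (j₀ - 1) := by
      rw [Finset.abs_prod]
      calc ∏ j ∈ (pwIndex h ι i).filter (fun j => j < k), |1 + δ j ω|
          ≤ ∏ _j ∈ (pwIndex h ι i).filter (fun j => j < k), (1 + u) :=
            Finset.prod_le_prod (fun _ _ => abs_nonneg _) (fun j _ =>
              (abs_add_le 1 (δ j ω)).trans (by rw [abs_one]; linarith [hm.bounded j ω]))
        _ = (1 + u) ^ ((pwIndex h ι i).filter (fun j => j < k)).card := Finset.prod_const _
        _ ≤ (1 + u) ^ (j₀ - 1) := pow_le_pow_right₀ h1u hcard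
    -- the node `(j₀, ⌊i/2^{j₀}⌋)` is numbered `k` and sits above leaf `i`
    have hν : (j₀, i / 2 ^ j₀)
        ∈ (pwNodes h).filter (fun ν => nodeTime ι ν = k ∧ i / 2 ^ ν.1 = ν.2) :=
      Finset.mem_filter.mpr ⟨mem_pwNodes.mpr ⟨hj₀1, hj₀h, div_pow_lt hi2' hj₀h⟩, hj₀k, rfl⟩
    calc |a i * ∏ j ∈ (pwIndex h ι i).filter (fun j => j < k), (1 + δ j ω)|
        = |a i| * |∏ j ∈ (pwIndex h ι i).filter (fun j => j < k), (1 + δ j ω)| := abs_mul _ _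
      _ ≤ |a i| * (1 + u) ^ (j₀ - 1) := mul_le_mul_of_nonneg_left hprod (abs_nonneg _)
      _ = (fun ν : ℕ × ℕ => (1 + u) ^ (ν.1 - 1) * |a i|) (j₀, i / 2 ^ j₀) := by
          simp only [mul_comm]
      _ ≤ ∑ ν ∈ (pwNodes h).filter (fun ν => nodeTime ι ν = k ∧ i / 2 ^ ν.1 = ν.2),
            (1 + u) ^ (ν.1 - 1) * |a i| :=
          Finset.single_le_sum (f := fun ν : ℕ × ℕ => (1 + u) ^ (ν.1 - 1) * |a i|)
            (fun ν _ => mul_nonneg (pow_nonneg (by linarith) _) (abs_nonneg _)) hν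
  unfold ahCoef
  calc |∑ i ∈ (range (2 ^ h)).filter (fun i => k ∈ pwIndex h ι i),
          a i * ∏ j ∈ (pwIndex h ι i).filter (fun j => j < k), (1 + δ j ω)|
      ≤ ∑ i ∈ (range (2 ^ h)).filter (fun i => k ∈ pwIndex h ι i),
          |a i * ∏ j ∈ (pwIndex h ι i).filter (fun j => j < k), (1 + δ j ω)| :=
        Finset.abs_sum_le_sum_abs _ _
    _ ≤ ∑ i ∈ (range (2 ^ h)).filter (fun i => k ∈ pwIndex h ι i),
          ∑ ν ∈ (pwNodes h).filter (fun ν => nodeTime ι ν = k ∧ i / 2 ^ ν.1 = ν.2),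
            (1 + u) ^ (ν.1 - 1) * |a i| := Finset.sum_le_sum hterm
    _ ≤ ∑ i ∈ range (2 ^ h),
          ∑ ν ∈ (pwNodes h).filter (fun ν => nodeTime ι ν = k ∧ i / 2 ^ ν.1 = ν.2),
            (1 + u) ^ (ν.1 - 1) * |a i| :=
        Finset.sum_le_sum_of_subset_of_nonneg (Finset.filter_subset _ _)
          (fun i _ _ => Finset.sum_nonneg (fun ν _ =>
            mul_nonneg (pow_nonneg (by linarith) _) (abs_nonneg _)))
    _ = timeBound h ι a u k := (timeBound_eq_sum_leaf h ι a u k).symm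

/-- **The martingale bound for pairwise summation under mean-independent errors** (the role of
[9, Thm. 3.5] in the proof of Theorem 2, here with the `γ_{2h}` radius of eq. (13)): for an
admissible numbering and `0 < λ`,
`|Σ_{i<2^h} aᵢ∏_{k∈Kᵢ}(1+δ_k) − Σaᵢ| ≤ (Σ|aᵢ|)√(uγ_{2h}(u))√(ln(2/λ))` with probability at least
`1 − λ` (Azuma–Hoeffding, `HallmanIpsen2023.azumaHoeffding`, with the increment bounds `A_k`).
[cite: ArarEtAl2026, Thm. 2 proof and eq. (13)] -/
theorem pwSum_measure_err_gt_le_AH [IsProbabilityMeasure μ] (hm : SRErrorModel μ u δ)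
    (hι : TreeNumbering h ι) (a : ℕ → ℝ) {lam : ℝ} (hlam : 0 < lam) :
    μ {ω | (∑ i ∈ range (2 ^ h), |a i|)
            * (Real.sqrt (u * gammaFn (2 * h) u) * Real.sqrt (Real.log (2 / lam)))
        < |(∑ i ∈ range (2 ^ h), a i * ∏ k ∈ pwIndex h ι i, (1 + δ k ω))
            - ∑ i ∈ range (2 ^ h), a i|} ≤ ENNReal.ofReal lam := by
  have hu : 0 ≤ u := u_nonneg hm
  set N := (pwNodes h).sup (nodeTime ι) + 1 with hNdef
  have hN : ∀ ν ∈ pwNodes h, nodeTime ι ν < N :=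
    fun ν hν => Nat.lt_succ_of_le (Finset.le_sup (f := nodeTime ι) hν)
  have hKN : ∀ i ∈ range (2 ^ h), pwIndex h ι i ⊆ range N := by
    intro i hi x hx
    simp only [pwIndex, Finset.mem_image] at hx
    obtain ⟨j, hj, rfl⟩ := hx
    obtain ⟨hj1, hjh⟩ := Finset.mem_Icc.mp hj
    exact Finset.mem_range.mpr
      (hN (j, i / 2 ^ j) (mem_pwNodes.mpr ⟨hj1, hjh, div_pow_lt (Finset.mem_range.mp hi) hjh⟩))
  have hS : 0 ≤ ∑ i ∈ range (2 ^ h), |a i| := Finset.sum_nonneg (fun _ _ => abs_nonneg _)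
  have hAH := azumaHoeffding hm (isPredictable_ahCoef (range (2 ^ h)) a (pwIndex h ι))
    (A := timeBound h ι a u) (abs_ahCoef_le_timeBound hm hι a) N hlam
  refine le_trans (measure_mono (fun ω hω => ?_)) hAH
  simp only [Set.mem_setOf_eq] at hω ⊢
  rw [← err_eq_transform_of_subset_range (range (2 ^ h)) a (pwIndex h ι) hKN δ ω]
  exact lt_of_le_of_lt
    (azumaRadius_le_of_two_mul_le lam hS (two_mul_sum_timeBound_sq_le hι a hu hN)) hω

/-- The same bound stated for `pairwiseComputed` (exact stochastic rounding, `β ≡ 0`: Theorem 2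
with `u_{p+r} = 0`). [cite: ArarEtAl2026, Thm. 2 (case `r = ∞`) and eq. (13)] -/
theorem pairwise_measure_err_gt_le_AH [IsProbabilityMeasure μ] (hm : SRErrorModel μ u δ)
    (hι : TreeNumbering h ι) (a : ℕ → ℝ) {lam : ℝ} (hlam : 0 < lam) :
    μ {ω | (∑ i ∈ range (2 ^ h), |a i|)
            * (Real.sqrt (u * gammaFn (2 * h) u) * Real.sqrt (Real.log (2 / lam)))
        < |pairwiseComputed h a ι (fun k => δ k ω) - ∑ i ∈ range (2 ^ h), a i|}
      ≤ ENNReal.ofReal lam := by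
  simp_rw [pairwiseComputed_eq_sum_prod hι]
  exact pwSum_measure_err_gt_le_AH hm hι a hlam

/-- **"Combining (10), (11), and (12)":** in the limited-precision model, if the error of the
recursive sum under the mean-independent errors `α` alone exceeds `(Σ|cᵢ|)·R` with probability at
most `p`, then the error under `δ = α + β` exceeds `(Σ|cᵢ|)·(R + γ_N(u_p+u_{p+r}) − γ_N(u_p))` with
probability at most `p` (`|Kᵢ| ≤ N`). [cite: ArarEtAl2026, Thm. 1 proof (last step); Thm. 2 proof
(last step)] -/
theorem measure_err_gt_le_of_split {up upr : ℝ} {α β : ℕ → Ω → ℝ}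
    (hmod : LimitedSRErrorModel μ up upr α β) (hup : 0 ≤ up) (hupr : 0 ≤ upr)
    {σ : Type*} (I : Finset σ) (c : σ → ℝ) (K : σ → Finset ℕ) {N : ℕ}
    (hN : ∀ i ∈ I, (K i).card ≤ N) (R : ℝ) {p : ENNReal}
    (hα : μ {ω | (∑ i ∈ I, |c i|) * R
        < |(∑ i ∈ I, c i * ∏ k ∈ K i, (1 + α k ω)) - ∑ i ∈ I, c i|} ≤ p) :
    μ {ω | (∑ i ∈ I, |c i|) * (R + (gammaFn N (up + upr) - gammaFn N up))
        < |(∑ i ∈ I, c i * ∏ k ∈ K i, (1 + (α k ω + β k ω))) - ∑ i ∈ I, c i|} ≤ p := by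
  refine le_trans (measure_mono (fun ω hω => ?_)) hα
  simp only [Set.mem_setOf_eq] at hω ⊢
  have hdet := abs_err_le_abs_err_add_bias I c K (fun k => α k ω) (fun k => β k ω) hup hupr
    (fun k => hmod.meanIndep.bounded k ω) (fun k => hmod.biasBounded k ω) hN
  beta_reduce at hdet
  rw [mul_add] at hω
  linarith

end Model

/-! ### The two named facts -/

/-- **Theorem 1 (Horner's algorithm under `SR_{p,r}`), PROVED:** discharges the named fact
`hornerBoundSRpr` — the deterministic split (Lemma 1, eqs. (10)–(11), `N = 2n`) on top of the
Azuma–Hoeffding bound of [8, Thm. 4.5] = `ElararEtAl2023.measure_err_gt_le_AH` for the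
mean-independent part (eq. (12)). [cite: ArarEtAl2026, Thm. 1] -/
theorem hornerBoundSRpr_holds : hornerBoundSRpr := by
  intro Ω _ μ _ up upr α β hupr hle _ hmod n a x lam hlam _
  have h4 : 4 * n = 2 * (2 * n) := by ring
  simp_rw [hornerEnvelope, h4, hornerComputed]
  exact measure_err_gt_le_of_split hmod (hupr.le.trans hle) hupr.le (range (n + 1))
    (fun i => a i * x ^ i) (fun i => Icc (max 1 (2 * (n - i))) (2 * n))
    (fun i _ => card_hornerIndex_le n i) _
    (measure_err_gt_le_AH hmod.meanIndep (range (n + 1)) (fun i => a i * x ^ i)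
      (fun i => Icc (max 1 (2 * (n - i))) (2 * n)) (fun i _ => hornerIndex_subset n i) hlam)

/-- **Theorem 2 (pairwise summation under `SR_{p,r}`), PROVED:** discharges the named fact
`pairwiseBoundSRpr` — the deterministic split (Lemma 1, `|Bᵢ| ≤ γ_h(u_p+u_{p+r}) − γ_h(u_p)`) on top
of the martingale bound `pwSum_measure_err_gt_le_AH` for the mean-independent part.
[cite: ArarEtAl2026, Thm. 2] -/
theorem pairwiseBoundSRpr_holds : pairwiseBoundSRpr := by
  intro Ω _ μ _ up upr α β hupr hle _ hmod h ι hι a lam hlam _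
  simp_rw [pairwiseEnvelope, pairwiseComputed_eq_sum_prod hι]
  exact measure_err_gt_le_of_split hmod (hupr.le.trans hle) hupr.le (range (2 ^ h)) a
    (pwIndex h ι) (fun i _ => card_pwIndex_le h ι i) _
    (pwSum_measure_err_gt_le_AH hmod.meanIndep hι a hlam)

end Literature.ComputerArithmetic.ElararEtAl2026
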